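import Summits.QuantumFields.YangMills.Theorems.BalabanStepParabolic.Negative.OverTunedInhabitant
import Summits.QuantumFields.YangMills.Theorems.BalabanStepParabolic.Negative.OverTunedLimit
import Summits.QuantumFields.YangMills.Theorems.ParabolicTrajectoryBalabanStepParabolicStubParabolicBlock
import Summits.QuantumFields.YangMills.Theorems.ParabolicTrajectoryBalabanStepParabolicStubRealisation
import HarnessLib

/-!
# `BalabanStepParabolic` — negative-side support: the content of the crux at odd `M` IS uniform over-tuned
# triviality (equivalence)

Crux `stmt-QuantumFields-9684`, drefute gen 2 (stub-misstated finding; note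
`Cruxes/BalabanStepParabolic/DREFUTE2-stub_regulatorChartOdd.md`). Packaging of `OverTunedLimit.lean` (⇒) and
`OverTunedInhabitant.lean` (⇐):

* `uniformOverTuned_of_nonempty`: the sequential statement `overtuned_trivial_of_nonempty` upgraded to the UNIFORM
  form used by the inhabitant (slope `B = 2/A`; a standard sup/sequence argument by contradiction).
* **`nonempty_iff_uniformOverTuned`**: for odd `M ≥ 2` and every compact `G`, `r`,
  `Nonempty (BalabanBanachStep G r M) ↔ ∃ B > 0, UOT(r, M, B)`.
* **`nonempty_regulatorChart_iff_uniformOverTuned`**: the same for the line's object `RegulatorChart G r M`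
  (via the landed stubs `stub_parabolicBlock`, `stub_realisation`).
Here `UOT(r, M, B)` is, verbatim, `∀ B' L m h, IsOffDiagonal … → ∀ ε > 0, ∃ k₀, ∀ k ≥ k₀, ∀ β ≥ B k − B',
|wilsonCentredSchwinger r.ρ β ((M^k(2L+1)−1)/2) 1 curvatureᵐ⁺¹ ((blockDilate M)^[k] ∘ h)| ≤ ε` — a statement about
Wilson's lattice gauge theory alone (no chart, no step, no `b₀`, no regulator).
-/

namespace Summit.QuantumFields.YangMills.Theorems.BalabanStepParabolic.Negative

open scoped SchwartzMap
open MeasureTheory Filter Topology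
open Literature.MathematicalPhysics.QuantumFieldTheory Literature.MathematicalPhysics.AQFT
open Literature.MathematicalPhysics.QuantumLattice

noncomputable section

variable {G : Type} [Group G] [TopologicalSpace G] [IsTopologicalGroup G] [CompactSpace G]
  [MeasurableSpace G] [BorelSpace G] (r : LatticeRep G) (M : ℕ)

/-- **Sequential ⇒ uniform.** Every inhabitant at odd `M` forces UNIFORM over-tuned triviality at some slope
`B > 0` (from `overtuned_trivial_of_nonempty`, slope `B = 2/A`, by contradiction along a violating sequence). [folklore] -/
theorem uniformOverTuned_of_nonempty (hMo : Odd M) (hS : Nonempty (BalabanBanachStep G r M)) :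
    ∃ B : ℝ, 0 < B ∧ ∀ (B' : ℝ) (L m : ℕ) (h : Fin (m + 1) → 𝓢(EuclideanSpace ℝ (Fin 4), ℝ)),
      IsOffDiagonal (SchwartzMap.tensorFin (m + 1) fun i => ofRealTest (h i)) →
      ∀ ε > 0, ∃ k₀ : ℕ, ∀ k ≥ k₀, ∀ β : ℝ, B * k - B' ≤ β →
        |wilsonCentredSchwinger r.ρ β ((M ^ k * (2 * L + 1) - 1) / 2) (fun _ => 1) (m + 1)
          (fun _ => r.curvature) (fun i => (blockDilate M)^[k] (h i))| ≤ ε := by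
  obtain ⟨β₀, A, hA, hseq⟩ := overtuned_trivial_of_nonempty (G := G) (r := r) (M := M) hMo hS
  refine ⟨2 / A, by positivity, fun B' L m h hh ε hε => ?_⟩
  by_contra hnot
  push Not at hnot
  -- a violating sequence: k i ≥ i, β i ≥ (2/A) k i − B', |W| > ε
  choose k hk β hβ hW using fun k₀ : ℕ => hnot k₀
  -- shift so that β ≥ β₀ and k ≤ A β hold everywhere
  obtain ⟨i₀, hi₀⟩ : ∃ i₀ : ℕ, ∀ i ≥ i₀, β₀ ≤ β i ∧ (k i : ℝ) ≤ A * β i := by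
    obtain ⟨N, hN⟩ := exists_nat_gt (max (A * (β₀ + B') / 2) (A * B'))
    refine ⟨N, fun i hi => ?_⟩
    have hki : (N : ℝ) ≤ k i := by exact_mod_cast (le_trans hi (hk i))
    have hkiA : (2 / A) * (k i) - B' ≤ β i := hβ i
    have h1 : A * (β₀ + B') / 2 < k i := lt_of_lt_of_le (lt_of_le_of_lt (le_max_left _ _) hN) hki
    have h2 : A * B' < k i := lt_of_lt_of_le (lt_of_le_of_lt (le_max_right _ _) hN) hki
    constructor
    · -- β i ≥ (2/A) k i − B' > β₀
      have : (2 / A) * (A * (β₀ + B') / 2) = β₀ + B' := by field_simp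
      have h3 : (2 / A) * (A * (β₀ + B') / 2) < (2 / A) * (k i) := by
        apply mul_lt_mul_of_pos_left h1 (by positivity)
      linarith
    · -- k i ≤ A β i  ⟸  k i ≤ A((2/A) k i − B') = 2 k i − A B'
      have h3 : A * ((2 / A) * (k i) - B') ≤ A * β i := mul_le_mul_of_nonneg_left hkiA hA.le
      have e : A * ((2 / A) * (k i) - B') = 2 * (k i) - A * B' := by field_simp
      rw [e] at h3
      linarith
  have hlim := hseq (fun i => β (i + i₀)) (fun i => k (i + i₀)) (fun i => (hi₀ (i + i₀) (by omega)).1)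
    (tendsto_add_atTop_nat i₀ |> fun h => ?_) (fun i => (hi₀ (i + i₀) (by omega)).2) L m h hh
  · have hev := (Metric.tendsto_nhds.1 hlim) ε hε
    obtain ⟨i, hi⟩ := hev.exists
    rw [Real.dist_eq, sub_zero] at hi
    exact (not_lt.2 (hW (i + i₀)).le) hi
  · -- Tendsto (fun i => k (i + i₀)) atTop atTop
    exact tendsto_atTop_mono (fun i => hk (i + i₀)) h

/-- **The crux's structure at odd `M` is inhabited iff uniform over-tuned triviality holds at some slope.**
For odd `M ≥ 2`, every compact `G` and every `r : LatticeRep G`: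
`Nonempty (BalabanBanachStep G r M) ↔ ∃ B > 0, UOT(r, M, B)` — the right-hand side mentions Wilson's lattice
gauge theory only. [folklore] -/
theorem nonempty_iff_uniformOverTuned (hMo : Odd M) (hM : 2 ≤ M) :
    Nonempty (BalabanBanachStep G r M) ↔
      ∃ B : ℝ, 0 < B ∧ ∀ (B' : ℝ) (L m : ℕ) (h : Fin (m + 1) → 𝓢(EuclideanSpace ℝ (Fin 4), ℝ)),
        IsOffDiagonal (SchwartzMap.tensorFin (m + 1) fun i => ofRealTest (h i)) →
        ∀ ε > 0, ∃ k₀ : ℕ, ∀ k ≥ k₀, ∀ β : ℝ, B * k - B' ≤ β →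
          |wilsonCentredSchwinger r.ρ β ((M ^ k * (2 * L + 1) - 1) / 2) (fun _ => 1) (m + 1)
            (fun _ => r.curvature) (fun i => (blockDilate M)^[k] (h i))| ≤ ε :=
  ⟨uniformOverTuned_of_nonempty r M hMo, fun ⟨_, hB, h⟩ => nonempty_of_uniformOverTuned r M hMo hM hB h⟩

/-- The line's object realises the crux's structure (composition of the landed stubs `stub_parabolicBlock` and
`stub_realisation` of line `perfect-action-regulator-chart`, per `(G, r, M)`). [folklore] -/
theorem nonempty_step_of_regulatorChart (h : Nonempty (RegulatorChart G r M)) :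
    Nonempty (BalabanBanachStep G r M) := by
  obtain ⟨𝒞⟩ := h
  have hs := 𝒞.smooth
  obtain ⟨φ', Ψ', C', hC', hagree, hPB, hBB⟩ :=
    Summit.QuantumFields.YangMills.Theorems.BalabanStepParabolic.stub_parabolicBlock 𝒞.E 𝒞.φ 𝒞.Ψ 𝒞.A
      𝒞.φg 𝒞.φy 𝒞.Ψg 𝒞.Ψy (𝒞.b₀ * Real.log M) 𝒞.C 𝒞.δ 𝒞.R 𝒞.θ' hs
  exact Summit.QuantumFields.YangMills.Theorems.BalabanStepParabolic.stub_realisation G r M 𝒞.E φ' Ψ' 𝒞.A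
    𝒞.b₀ 𝒞.θ C' 𝒞.δ 𝒞.R 𝒞.θ' 𝒞.two_le_M 𝒞.b₀_pos 𝒞.θ_nonneg 𝒞.θ_lt_one 𝒞.norm_A_le hC' hs.δ_pos
    hs.δ_le_R hs.θ'_nonneg 𝒞.θ'_lt_one hPB hBB 𝒞.yW 𝒞.g₀ 𝒞.betaOf 𝒞.κ 𝒞.K 𝒞.corr
    (𝒞.realisation.congr hagree)

/-- **The line's object at odd `M` is inhabited iff uniform over-tuned triviality holds at some slope**:
`Nonempty (RegulatorChart G r M) ↔ ∃ B > 0, UOT(r, M, B)` for odd `M ≥ 2` — so the load-bearing stub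
`stub_regulatorChartOdd` of line `perfect-action-regulator-chart` is, per `(G, r, M)`, exactly this RG-free
statement about Wilson's theory in the over-tuned weak-coupling regime. [folklore] -/
theorem nonempty_regulatorChart_iff_uniformOverTuned (hMo : Odd M) (hM : 2 ≤ M) :
    Nonempty (RegulatorChart G r M) ↔
      ∃ B : ℝ, 0 < B ∧ ∀ (B' : ℝ) (L m : ℕ) (h : Fin (m + 1) → 𝓢(EuclideanSpace ℝ (Fin 4), ℝ)),
        IsOffDiagonal (SchwartzMap.tensorFin (m + 1) fun i => ofRealTest (h i)) →
        ∀ ε > 0, ∃ k₀ : ℕ, ∀ k ≥ k₀, ∀ β : ℝ, B * k - B' ≤ β →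
          |wilsonCentredSchwinger r.ρ β ((M ^ k * (2 * L + 1) - 1) / 2) (fun _ => 1) (m + 1)
            (fun _ => r.curvature) (fun i => (blockDilate M)^[k] (h i))| ≤ ε :=
  ⟨fun h => uniformOverTuned_of_nonempty r M hMo (nonempty_step_of_regulatorChart r M h),
    fun ⟨_, hB, h⟩ => nonempty_regulatorChart_of_uniformOverTuned r M hMo hM hB h⟩
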